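import Summits.NavierStokesRegularity.NavierStokesRegularity.Theorems.ExtremiserTransienceNearExtremalTransienceExtremiserLiouvilleNewtonGradientBound
import Literature.Analysis.FluidPDE.NewtonPotentialGradientFarField
import Literature.Analysis.FluidPDE.AntidivergenceLiftBounds
import HarnessLib

/-!
# Crux `ExtremiserTransience.NearExtremalTransience` (stmt-NavierStokesRegularity-21883), line `extremiser_liouville`,
# stub K1b — potential-theoretic brick 2: decay `O((1+|y|)⁻³)` of the second and third derivatives of `Γ ∗ φ`, `φ ∈ C^∞_c`

`--supports stmt-NavierStokesRegularity-21883` (helper).  Author: prover seat `ns-el-k1b` (g5).  Second brick for step (ii) of the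
axial-truncation attack (`Cruxes/NearExtremalTransience/Lines/extremiser_liouville_k1b_jet.md` §4): the Leray corrector
`∇π[G]`, `π[G] = Γ ∗ div G`, must lie in the global tangent class of `…ConstantSpeedLocalisedKKT` (bounded gradient, `D¹, D² ∈ L²`).
For a test function `φ ∈ C^∞_c(ℝ³)` and `N[φ](y) = ∫ Γ(y − x)φ(x)dx`:

* `fderiv_newtonPotential_apply_eq_integral` — `∂ₐN[φ](y) = ∫ ∂ₐΓ(y − x)φ(x)dx`; `fderiv_newtonPotential_apply_eq_newtonPotential` —
  `∂ₐN[φ] = N[∂ₐφ]` (tree `fderiv_integral_newtonKernel_mul_apply`, `integral_newtonKernel_smul_fderiv_eq`);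
* `exists_decay_fderiv_newtonPotential` — if `∫φ = 0`: `(1+‖y‖)³|∂ₐN[φ](y)| ≤ K‖a‖` (the tree's far-field expansion
  `exists_forall_one_add_norm_pow_three_mul_abs_integral_le`, monopole term absent);
* `exists_norm_fderiv_fderiv_newtonPotential_le`, `exists_norm_fderiv3_newtonPotential_apply_le` — **`‖D²N[φ](y)‖ ≤ C(1+‖y‖)⁻³`,
  `‖D³N[φ](y)h‖ ≤ C(1+‖y‖)⁻³‖h‖`** (the partial derivatives `∂_bφ`, `∂_c∂_bφ` have zero mean; operator norms by the values on the standard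
  basis, `CP25.opNorm_le_sum_single`);
* `fderiv_apply_const_apply` — `D(y ↦ c(y)a)(y)h = (Dc(y)h)a` for `CLM`-valued `c`.

Standard potential theory (Gilbarg–Trudinger Lemma 4.1–4.2, (2.14); Lemarié-Rieusset 2016 §4.10 for the far field).

WHAT THIS IS NOT: K1b is NOT proved; nothing here proves NS regularity. [folklore]
-/

noncomputable section

open MeasureTheory Set Function Filter Metric Real
open _root_.Topology
open scoped ENNReal NNReal InnerProductSpace RealInnerProductSpace

namespace Summit.NavierStokesRegularity.NavierStokesRegularity.Theorems

-- the problem directory repeats the summit name (`NavierStokesRegularity/NavierStokesRegularity`)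
set_option linter.dupNamespace false

namespace ExtremiserLiouville

open Literature.Analysis.FluidPDE

variable {φ : EuclideanSpace ℝ (Fin 3) → ℝ}

/-! ### Small tools -/

/-- `D(y ↦ c(y) a)(y) h = (Dc(y) h) a` for a differentiable `CLM`-valued map `c` and a constant vector `a`. [folklore] -/
theorem fderiv_apply_const_apply {F : Type*} [NormedAddCommGroup F] [NormedSpace ℝ F]
    {c : EuclideanSpace ℝ (Fin 3) → (EuclideanSpace ℝ (Fin 3) →L[ℝ] F)} {y : EuclideanSpace ℝ (Fin 3)}
    (hc : DifferentiableAt ℝ c y) (a h : EuclideanSpace ℝ (Fin 3)) :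
    fderiv ℝ (fun z => c z a) y h = fderiv ℝ c y h a := by
  rw [fderiv_clm_apply hc (differentiableAt_const a), fderiv_fun_const]
  simp [ContinuousLinearMap.flip_apply]

/-- A `C^∞_c` scalar test function: integrable, with integrable first moment, bounded, with bounded `‖y‖⁴|φ|`. [folklore] -/
theorem testFunction_bounds (hφ : ContDiff ℝ (⊤ : ℕ∞) φ) (hφc : HasCompactSupport φ) :
    Integrable φ volume ∧ Integrable (fun y => ‖y‖ * φ y) volume ∧
      (∃ C₀ : ℝ, ∀ y, |φ y| ≤ C₀) ∧ ∃ C₄ : ℝ, ∀ y, ‖y‖ ^ 4 * |φ y| ≤ C₄ := by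
  refine ⟨hφ.continuous.integrable_of_hasCompactSupport hφc,
    (continuous_norm.mul hφ.continuous).integrable_of_hasCompactSupport hφc.mul_left, ?_, ?_⟩
  · obtain ⟨C, hC⟩ := hφ.continuous.bounded_above_of_compact_support hφc
    exact ⟨C, fun y => by rw [← Real.norm_eq_abs]; exact hC y⟩
  · have hc4 : Continuous fun y : EuclideanSpace ℝ (Fin 3) => ‖y‖ ^ 4 * φ y := (continuous_norm.pow 4).mul hφ.continuous
    have hs4 : HasCompactSupport fun y : EuclideanSpace ℝ (Fin 3) => ‖y‖ ^ 4 * φ y := hφc.mul_left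
    obtain ⟨C, hC⟩ := hc4.bounded_above_of_compact_support hs4
    refine ⟨C, fun y => ?_⟩
    have h := hC y
    rw [Real.norm_eq_abs, abs_mul, abs_of_nonneg (by positivity)] at h
    exact h

/-! ### The gradient of `N[φ]` -/

/-- `∂ₐN[φ](y) = ∫ ∂ₐΓ(y − x) φ(x) dx` for `φ ∈ C^∞_c`. [folklore] -/
theorem fderiv_newtonPotential_apply_eq_integral (hφ : ContDiff ℝ (⊤ : ℕ∞) φ) (hφc : HasCompactSupport φ)
    (y a : EuclideanSpace ℝ (Fin 3)) :
    fderiv ℝ (fun y => ∫ x, newtonKernel (y - x) * φ x) y a = ∫ x, fderiv ℝ newtonKernel (y - x) a * φ x := by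
  rw [fderiv_integral_newtonKernel_mul_apply hφ hφc y a]
  have h2 := integral_newtonKernel_smul_fderiv_eq (F := ℝ) (contDiff_infty.1 hφ 1) hφc y a
  simp only [smul_eq_mul] at h2
  exact h2

/-- `∂ₐN[φ] = N[∂ₐφ]` as functions (the derivative falls on the test function). [folklore] -/
theorem fderiv_newtonPotential_apply_eq_newtonPotential (hφ : ContDiff ℝ (⊤ : ℕ∞) φ) (hφc : HasCompactSupport φ)
    (a : EuclideanSpace ℝ (Fin 3)) :
    (fun y => fderiv ℝ (fun y => ∫ x, newtonKernel (y - x) * φ x) y a) =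
      fun y => ∫ x, newtonKernel (y - x) * (fun x => fderiv ℝ φ x a) x :=
  funext fun y => fderiv_integral_newtonKernel_mul_apply hφ hφc y a

/-- The directional derivative `∂ₐφ` of a test function is a test function with zero mean. [folklore] -/
theorem testFunction_fderiv_apply (hφ : ContDiff ℝ (⊤ : ℕ∞) φ) (hφc : HasCompactSupport φ) (a : EuclideanSpace ℝ (Fin 3)) :
    ContDiff ℝ (⊤ : ℕ∞) (fun x => fderiv ℝ φ x a) ∧ HasCompactSupport (fun x => fderiv ℝ φ x a) ∧
      ∫ x, fderiv ℝ φ x a = 0 :=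
  ⟨(contDiff_infty_iff_fderiv.1 hφ).2.clm_apply contDiff_const, hφc.fderiv_apply (𝕜 := ℝ) a,
    integral_fderiv_apply_eq_zero (contDiff_infty.1 hφ 1) hφc a⟩

/-- **Decay of `∇N[φ]` for a zero-mean test function**: `(1+‖y‖)³ |∂ₐN[φ](y)| ≤ K ‖a‖`. [folklore] -/
theorem exists_decay_fderiv_newtonPotential (hφ : ContDiff ℝ (⊤ : ℕ∞) φ) (hφc : HasCompactSupport φ)
    (h0 : ∫ x, φ x = 0) :
    ∃ K : ℝ, 0 ≤ K ∧ ∀ y a : EuclideanSpace ℝ (Fin 3),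
      (1 + ‖y‖) ^ 3 * |fderiv ℝ (fun y => ∫ x, newtonKernel (y - x) * φ x) y a| ≤ K * ‖a‖ := by
  obtain ⟨K, hK, hbound⟩ := exists_forall_one_add_norm_pow_three_mul_abs_integral_le
  obtain ⟨hi, hm, ⟨C₀, hC₀⟩, ⟨C₄, hC₄⟩⟩ := testFunction_bounds hφ hφc
  have hC₀0 : 0 ≤ C₀ := (abs_nonneg _).trans (hC₀ 0)
  have hC₄0 : 0 ≤ C₄ := le_trans (by positivity) (hC₄ 0)
  refine ⟨K * (C₀ + (∫ y, |φ y|) + (∫ y, ‖y‖ * |φ y|) + C₄), ?_, fun y a => ?_⟩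
  · have h1 : 0 ≤ ∫ y, |φ y| := integral_nonneg fun _ => abs_nonneg _
    have h2 : 0 ≤ ∫ y, ‖y‖ * |φ y| := integral_nonneg fun _ => by positivity
    positivity
  · rw [fderiv_newtonPotential_apply_eq_integral hφ hφc]
    exact hbound hi hm hC₀ hC₄ h0 y a

/-! ### Decay of `D²N[φ]` and `D³N[φ]` -/

set_option synthInstance.maxHeartbeats 200000 in
/-- `N[φ]` is smooth (tree) — restated with the derivative tower: `DN[φ]` and `D²N[φ]` are differentiable. [folklore] -/
theorem differentiable_fderiv_newtonPotential (hφ : ContDiff ℝ (⊤ : ℕ∞) φ) (hφc : HasCompactSupport φ) :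
    Differentiable ℝ (fderiv ℝ (fun y => ∫ x, newtonKernel (y - x) * φ x)) ∧
      Differentiable ℝ (fderiv ℝ (fderiv ℝ (fun y => ∫ x, newtonKernel (y - x) * φ x))) := by
  have hN := contDiff_integral_newtonKernel_mul hφ hφc
  have h1 : ContDiff ℝ (⊤ : ℕ∞) (fderiv ℝ (fun y => ∫ x, newtonKernel (y - x) * φ x)) := (contDiff_infty_iff_fderiv.1 hN).2
  have h2 : ContDiff ℝ (⊤ : ℕ∞) (fderiv ℝ (fderiv ℝ (fun y => ∫ x, newtonKernel (y - x) * φ x))) :=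
    (contDiff_infty_iff_fderiv.1 h1).2
  exact ⟨h1.differentiable (by simp), h2.differentiable (by simp)⟩

/-- **`‖D²N[φ](y)‖ ≤ C (1+‖y‖)⁻³`** for every test function `φ` (each `∂_b∂_aN[φ] = ∂_bN[∂_aφ]` and `∂_aφ` has zero mean). [folklore] -/
theorem exists_norm_fderiv_fderiv_newtonPotential_le (hφ : ContDiff ℝ (⊤ : ℕ∞) φ) (hφc : HasCompactSupport φ) :
    ∃ C : ℝ, 0 ≤ C ∧ ∀ y : EuclideanSpace ℝ (Fin 3),
      ‖fderiv ℝ (fderiv ℝ (fun y => ∫ x, newtonKernel (y - x) * φ x)) y‖ ≤ C * ((1 + ‖y‖) ^ 3)⁻¹ := by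
  set N : EuclideanSpace ℝ (Fin 3) → ℝ := fun y => ∫ x, newtonKernel (y - x) * φ x with hNdef
  obtain ⟨hdN, -⟩ := differentiable_fderiv_newtonPotential hφ hφc
  -- decay constants for the three partial derivatives `∂_m φ`
  have hK : ∀ m : Fin 3, ∃ K : ℝ, 0 ≤ K ∧ ∀ y b : EuclideanSpace ℝ (Fin 3),
      (1 + ‖y‖) ^ 3 * |fderiv ℝ (fderiv ℝ N) y b (EuclideanSpace.single m (1 : ℝ))| ≤ K * ‖b‖ := by
    intro m
    obtain ⟨hφm, hφmc, hφm0⟩ := testFunction_fderiv_apply hφ hφc (EuclideanSpace.single m (1 : ℝ))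
    obtain ⟨K, hK0, hKb⟩ := exists_decay_fderiv_newtonPotential hφm hφmc hφm0
    refine ⟨K, hK0, fun y b => ?_⟩
    have e : fderiv ℝ (fderiv ℝ N) y b (EuclideanSpace.single m (1 : ℝ)) =
        fderiv ℝ (fun y => ∫ x, newtonKernel (y - x) * (fun x => fderiv ℝ φ x (EuclideanSpace.single m (1 : ℝ))) x) y b := by
      rw [← fderiv_apply_const_apply (hdN y), ← fderiv_newtonPotential_apply_eq_newtonPotential hφ hφc]
    rw [e]
    exact hKb y b
  choose K hK0 hKb using hK
  refine ⟨∑ l : Fin 3, ∑ m : Fin 3, K m, Finset.sum_nonneg fun l _ => Finset.sum_nonneg fun m _ => hK0 m, fun y => ?_⟩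
  have hy : 0 < (1 + ‖y‖) ^ 3 := by positivity
  calc ‖fderiv ℝ (fderiv ℝ N) y‖ ≤ ∑ l, ‖fderiv ℝ (fderiv ℝ N) y (EuclideanSpace.single l (1 : ℝ))‖ := CP25.opNorm_le_sum_single _
    _ ≤ ∑ l, ∑ m, ‖fderiv ℝ (fderiv ℝ N) y (EuclideanSpace.single l (1 : ℝ)) (EuclideanSpace.single m (1 : ℝ))‖ :=
        Finset.sum_le_sum fun l _ => CP25.opNorm_le_sum_single _
    _ ≤ ∑ l : Fin 3, ∑ m : Fin 3, K m * ((1 + ‖y‖) ^ 3)⁻¹ := by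
        refine Finset.sum_le_sum fun l _ => Finset.sum_le_sum fun m _ => ?_
        rw [Real.norm_eq_abs, ← div_eq_mul_inv, le_div_iff₀ hy, mul_comm]
        have h := hKb m y (EuclideanSpace.single l (1 : ℝ))
        rw [PiLp.norm_single, norm_one, mul_one] at h
        exact h
    _ = (∑ l : Fin 3, ∑ m : Fin 3, K m) * ((1 + ‖y‖) ^ 3)⁻¹ := by rw [Finset.sum_mul]; exact Finset.sum_congr rfl fun l _ => by rw [Finset.sum_mul]

/-- **`‖D³N[φ](y) h‖ ≤ C (1+‖y‖)⁻³ ‖h‖`** for every test function `φ` (`∂_c∂_b∂_aN[φ] = ∂_cN[∂_b∂_aφ]`; stated on each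
first argument `h` to stay with doubly nested operator norms). [folklore] -/
theorem exists_norm_fderiv3_newtonPotential_apply_le (hφ : ContDiff ℝ (⊤ : ℕ∞) φ) (hφc : HasCompactSupport φ) :
    ∃ C : ℝ, 0 ≤ C ∧ ∀ y h : EuclideanSpace ℝ (Fin 3),
      ‖fderiv ℝ (fderiv ℝ (fderiv ℝ (fun y => ∫ x, newtonKernel (y - x) * φ x))) y h‖ ≤ C * ((1 + ‖y‖) ^ 3)⁻¹ * ‖h‖ := by
  set N : EuclideanSpace ℝ (Fin 3) → ℝ := fun y => ∫ x, newtonKernel (y - x) * φ x with hNdef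
  obtain ⟨hdN, hd2N⟩ := differentiable_fderiv_newtonPotential hφ hφc
  -- the second partials as Newton potentials of `∂_l∂_m φ`
  have hK : ∀ l m : Fin 3, ∃ K : ℝ, 0 ≤ K ∧ ∀ y b : EuclideanSpace ℝ (Fin 3),
      (1 + ‖y‖) ^ 3 * |fderiv ℝ (fderiv ℝ (fderiv ℝ N)) y b (EuclideanSpace.single l (1 : ℝ)) (EuclideanSpace.single m (1 : ℝ))| ≤
        K * ‖b‖ := by
    intro l m
    set em : EuclideanSpace ℝ (Fin 3) := EuclideanSpace.single m (1 : ℝ)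
    set el : EuclideanSpace ℝ (Fin 3) := EuclideanSpace.single l (1 : ℝ)
    obtain ⟨hφm, hφmc, -⟩ := testFunction_fderiv_apply hφ hφc em
    obtain ⟨hφml, hφmlc, hφml0⟩ := testFunction_fderiv_apply hφm hφmc el
    obtain ⟨K, hK0, hKb⟩ := exists_decay_fderiv_newtonPotential hφml hφmlc hφml0
    refine ⟨K, hK0, fun y b => ?_⟩
    have e1 : (fun z => fderiv ℝ N z em) = fun z => ∫ x, newtonKernel (z - x) * (fun x => fderiv ℝ φ x em) x :=
      fderiv_newtonPotential_apply_eq_newtonPotential hφ hφc em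
    have e2 : (fun z => fderiv ℝ (fderiv ℝ N) z el em) =
        fun z => ∫ x, newtonKernel (z - x) * (fun x => fderiv ℝ (fun x => fderiv ℝ φ x em) x el) x := by
      have h1 : (fun z => fderiv ℝ (fderiv ℝ N) z el em) = fun z => fderiv ℝ (fun w => fderiv ℝ N w em) z el :=
        funext fun z => (fderiv_apply_const_apply (hdN z) em el).symm
      rw [h1, e1, ← fderiv_newtonPotential_apply_eq_newtonPotential hφm hφmc el]
    have e3 : fderiv ℝ (fderiv ℝ (fderiv ℝ N)) y b el em = fderiv ℝ (fun z => fderiv ℝ (fderiv ℝ N) z el em) y b := by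
      have hdc : DifferentiableAt ℝ (fun z => fderiv ℝ (fderiv ℝ N) z el) y :=
        (hd2N y).clm_apply (differentiableAt_const el)
      rw [← fderiv_apply_const_apply (hd2N y) el b, ← fderiv_apply_const_apply hdc em b]
    rw [e3, e2]
    exact hKb y b
  choose K hK0 hKb using hK
  refine ⟨∑ l : Fin 3, ∑ m : Fin 3, K l m, Finset.sum_nonneg fun l _ => Finset.sum_nonneg fun m _ => hK0 l m, fun y h => ?_⟩
  have hy : 0 < (1 + ‖y‖) ^ 3 := by positivity
  calc ‖fderiv ℝ (fderiv ℝ (fderiv ℝ N)) y h‖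
      ≤ ∑ l, ‖fderiv ℝ (fderiv ℝ (fderiv ℝ N)) y h (EuclideanSpace.single l (1 : ℝ))‖ := CP25.opNorm_le_sum_single _
    _ ≤ ∑ l, ∑ m, ‖fderiv ℝ (fderiv ℝ (fderiv ℝ N)) y h (EuclideanSpace.single l (1 : ℝ)) (EuclideanSpace.single m (1 : ℝ))‖ :=
        Finset.sum_le_sum fun l _ => CP25.opNorm_le_sum_single _
    _ ≤ ∑ l : Fin 3, ∑ m : Fin 3, K l m * ((1 + ‖y‖) ^ 3)⁻¹ * ‖h‖ := by
        refine Finset.sum_le_sum fun l _ => Finset.sum_le_sum fun m _ => ?_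
        rw [Real.norm_eq_abs, mul_assoc, ← div_eq_inv_mul, mul_div_assoc', le_div_iff₀ hy, mul_comm]
        exact hKb l m y h
    _ = (∑ l : Fin 3, ∑ m : Fin 3, K l m) * ((1 + ‖y‖) ^ 3)⁻¹ * ‖h‖ := by
        rw [Finset.sum_mul, Finset.sum_mul]
        exact Finset.sum_congr rfl fun l _ => by rw [Finset.sum_mul, Finset.sum_mul]

end ExtremiserLiouville

end Summit.NavierStokesRegularity.NavierStokesRegularity.Theorems

end
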